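import Summits.QuantumFields.YangMills.Theorems.BalabanUVNodesN15TorusReflectionsDeltaA
import HarnessLib

/-!
# Route «BalabanUVNodes» (K3⁷), node N15 = NE2, -a lane, PROGRAMME N file N-Ic: BLOCK TRANSLATIONS OF THE TORUS `T_η` COMMUTE WITH BAŁABAN's `Δ_a` AND
# `G = Δ_a⁻¹`; THE REFLECTIONS IN THE FACES OF A TRANSLATED CUBE

Cell `pub-ymgap`, seat `pub-ymgap-dag-n15-a` (KNIT-BY-NAME, g19; D-0062; chair R424 venue; `bears_on: R4∕N15`); `--kind proof --supports stmt-QuantumFields-20544 --as helper`.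
Sequel of N-Ia∕N-Ib (`…N15TorusReflections`, `…N15TorusReflectionsDeltaA`).  WHY: the Neumann-by-images cube propagator of [Balaban1984PropagatorsII] (2.37) for a
block-aligned cube `□ + c` at an ARBITRARY unit-lattice position `c` is built from the reflections in the faces of `□ + c`, i.e. the conjugates `τ_{−n·c} ∘ R_κ ∘ τ_{n·c}`
of N-Ia's reflections by the block translation `τ_{n·c}`; so besides N-Ib's reflection equivariance one needs: Bałaban's `Δ_a` ([Balaban1984PropagatorsI] (1.69)∕(1.73))
commutes with BLOCK translations of `T_η` (translations by unit-lattice vectors — the averaging operators `Q`, `Q′` are block-periodic, not translation invariant).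

WHAT.  §5 translation matrices `transS`∕`transV` (`(T_vf)(x) = f(x+v)`), adjoints `T_vᴴ = T_{−v}`, and the equivariance of the b05 letters: `LapS`, `GradOp`, `LapV`,
`Pker`, `LapSinv` (N-Ib's `comm_LapSinv_of_comm`) for EVERY `v`; `QsOp`, ★ `QvOp` (`bpt (y + c) j = bpt y j + n·c`), `QvAdj`, `Mop`, `Cavg`, `Kmat`, `Minv`, `PcT`,
★★ `DeltaA`, ★★ `(DeltaA)⁻¹`, `DeltaAR`, `GR` for BLOCK vectors `v = up n M c`.  §6 the real forms: `tshiftV_eq_mulVecLin` (this lineage's `tshiftV` IS `re T_v`),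
★★★ `tshiftV_comp_deltaOp`, ★★★ `tshiftV_comp_gOp`; the face reflections of a translated cube `reflVRAt M n c κ := τ_{−n·c} ∘ R_κ ∘ τ_{n·c}` with `reflVRAt_reflVRAt`,
★★★ `reflVRAt_comp_gOp`, `reflVRAt_comp_deltaOp`.
HONEST FRAMING.  Finite-dimensional lattice algebra; no estimate; `U ≡ 1` torus MODEL of [B5] §1; nothing of [B6]∕[B9] asserted; N15 NOT discharged (object-bound; NE2⁺ NOT
PRINTED); counts UNMOVED (typed 28∕28 · discharged 5∕27); one finite torus at fixed lattice spacing — NOT continuum ∕ ℝ⁴ ∕ OS ∕ mass gap ∕ Clay.  Plumbing defs are DATA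
(two matrices, one real linear map); every theorem is [folklore] lattice algebra about printed objects.
-/

noncomputable section

open scoped BigOperators Matrix ComplexConjugate
open Finset

namespace Summit.QuantumFields.YangMills.BalabanUVNodes.N15.TwoGrid

open Literature.MathematicalPhysics.QuantumFieldTheory.Balaban1983to89
open Literature.MathematicalPhysics.QuantumFieldTheory.Balaban1983to89.B5Prop11Plancherel (Tor fine unitVec shiftM fdiff)
open Literature.MathematicalPhysics.QuantumFieldTheory.Balaban1983to89.B5Block118 (tstep up upHom iota bpt lineSum QsOp QvOp QsOp_mulVec QvOp_mulVec tstep_succ)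
open Literature.MathematicalPhysics.QuantumFieldTheory.Balaban1983to89.B5Action121 (shiftS sdiff sdiff_mulVec GradOp GradOp_mulVec LapS LapS_mulVec LapV)
open Literature.MathematicalPhysics.QuantumFieldTheory.Balaban1983to89.B5Prop11Lower (Lap)
open Literature.MathematicalPhysics.QuantumFieldTheory.Balaban1983to89.B5LaplaceInverse (LapSinv Pker LapS_mul_LapSinv LapSinv_mul_LapS LapSinv_mul_Pker
  Pker_mul_LapSinv Pker_const Pker_orth)
open Literature.MathematicalPhysics.QuantumFieldTheory.Balaban1983to89.B5Substitution125 (Mop Cavg Kmat Minv Kmat_isUnit)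
open Literature.MathematicalPhysics.QuantumFieldTheory.Balaban1983to89.B5Projection127 (Pc)
open Literature.MathematicalPhysics.QuantumFieldTheory.Balaban1983to89.B5Value126 (PcT)
open Literature.MathematicalPhysics.QuantumFieldTheory.Balaban1983to89.B5DeltaA169 (DeltaA QvAdj isUnit_DeltaA)
open Literature.MathematicalPhysics.QuantumFieldTheory.Balaban1983to89.B5RealFields (IsReal reM GR DeltaAR isReal_DeltaA)

variable {d : ℕ}


/-! ## §5 Translations of the torus and the (block-)translation equivariance of the b05 letters -/

section Translations

variable (N : Fin d → ℕ) [∀ μ, NeZero (N μ)]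

/-- the translation `(T_v f)(x) = f(x + v)` of scalar lattice functions, as a matrix. [folklore] -/
def transS (v : Tor N) : Matrix (Tor N) (Tor N) ℂ := fun x y => if y = x + v then 1 else 0

/-- the translation `(T_v A)(x, μ) = A(x + v, μ)` of lattice 1-forms (the bond direction is passive), as a matrix. [folklore] -/
def transV (v : Tor N) : Matrix (Tor N × Fin d) (Tor N × Fin d) ℂ := fun i j => if j = (i.1 + v, i.2) then 1 else 0

variable {N}

/-- `(T_v f)(x) = f(x + v)`. [folklore] -/
theorem transS_mulVec (v : Tor N) (f : Tor N → ℂ) (x : Tor N) : (transS N v *ᵥ f) x = f (x + v) := by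
  simp only [Matrix.mulVec, dotProduct, transS, ite_mul, one_mul, zero_mul, Finset.sum_ite_eq', Finset.mem_univ, if_true]

/-- `(T_v A)(x, μ) = A(x + v, μ)`. [folklore] -/
theorem transV_mulVec (v : Tor N) (A : Tor N × Fin d → ℂ) (x : Tor N) (μ : Fin d) : (transV N v *ᵥ A) (x, μ) = A (x + v, μ) := by
  simp only [Matrix.mulVec, dotProduct, transV, ite_mul, one_mul, zero_mul, Finset.sum_ite_eq', Finset.mem_univ, if_true]

omit [∀ μ, NeZero (N μ)] in
/-- `T_v` is real. [folklore] -/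
theorem isReal_transS (v : Tor N) : IsReal (transS N v) := fun x y => by unfold transS; split_ifs <;> simp

omit [∀ μ, NeZero (N μ)] in
/-- `T_v` is real (1-forms). [folklore] -/
theorem isReal_transV (v : Tor N) : IsReal (transV N v) := fun i j => by unfold transV; split_ifs <;> simp

omit [∀ μ, NeZero (N μ)] in
/-- `(T_v)ᴴ = T_{−v}`. [folklore] -/
theorem transS_conjTranspose (v : Tor N) : (transS N v)ᴴ = transS N (-v) := by
  ext x y
  simp only [Matrix.conjTranspose_apply, transS]
  by_cases h : x = y + v
  · rw [if_pos h, if_pos (by rw [h]; abel)]; simp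
  · rw [if_neg h, if_neg (fun h' => h (by rw [h']; abel))]; simp

omit [∀ μ, NeZero (N μ)] in
/-- `(T_v)ᴴ = T_{−v}` (1-forms). [folklore] -/
theorem transV_conjTranspose (v : Tor N) : (transV N v)ᴴ = transV N (-v) := by
  ext i j
  simp only [Matrix.conjTranspose_apply, transV]
  by_cases h : i = (j.1 + v, j.2)
  · rw [if_pos h, if_pos (by rw [h]; simp)]; simp
  · rw [if_neg h, if_neg]; · simp
    intro h'; apply h; rw [h']; simp

/-- `T_{−v}T_v = 1`. [folklore] -/
theorem transS_neg_mul (v : Tor N) : transS N (-v) * transS N v = 1 := by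
  refine matrix_eq_of_mulVec_eq fun f => funext fun x => ?_
  rw [← Matrix.mulVec_mulVec, transS_mulVec, transS_mulVec, Matrix.one_mulVec, neg_add_cancel_right]

/-- `T_{−v}T_v = 1` (1-forms). [folklore] -/
theorem transV_neg_mul (v : Tor N) : transV N (-v) * transV N v = 1 := by
  refine matrix_eq_of_mulVec_eq fun A => funext fun i => ?_
  obtain ⟨x, μ⟩ := i
  rw [← Matrix.mulVec_mulVec, transV_mulVec, transV_mulVec, Matrix.one_mulVec, neg_add_cancel_right]

/-- `Σ_x f(x + v) = Σ_x f(x)`. [folklore] -/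
theorem sum_add_right {α : Type} [AddCommMonoid α] (v : Tor N) (f : Tor N → α) : ∑ x, f (x + v) = ∑ x, f x :=
  Equiv.sum_comp (Equiv.addRight v) f

/-- transport of an equivariance through adjoints for translations: `T_vX = XT̃_w` gives `T̃_{−w}Xᴴ = XᴴT_{−v}`. [folklore] -/
theorem conjTranspose_comm_trans {N' : Fin d → ℕ} [∀ μ, NeZero (N' μ)] {X : Matrix (Tor N) (Tor N') ℂ} {v : Tor N} {w : Tor N'}
    (h : transS N v * X = X * transS N' w) : transS N' (-w) * Xᴴ = Xᴴ * transS N (-v) := by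
  have := congrArg Matrix.conjTranspose h
  rw [Matrix.conjTranspose_mul, Matrix.conjTranspose_mul, transS_conjTranspose, transS_conjTranspose] at this
  exact this.symm

/-- the same for 1-form translations. [folklore] -/
theorem conjTranspose_comm_transV {N' : Fin d → ℕ} [∀ μ, NeZero (N' μ)] {X : Matrix (Tor N × Fin d) (Tor N' × Fin d) ℂ} {v : Tor N} {w : Tor N'}
    (h : transV N v * X = X * transV N' w) : transV N' (-w) * Xᴴ = Xᴴ * transV N (-v) := by
  have := congrArg Matrix.conjTranspose h
  rw [Matrix.conjTranspose_mul, Matrix.conjTranspose_mul, transV_conjTranspose, transV_conjTranspose] at this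
  exact this.symm

variable (N) (c : ℂ) (v : Tor N)

/-- `T_vΔ = ΔT_v` (scalar Laplacian). [cite: Balaban1984PropagatorsI, (1.21) p.21] -/
theorem transS_mul_LapS : transS N v * LapS N c = LapS N c * transS N v := by
  refine matrix_eq_of_mulVec_eq fun f => funext fun x => ?_
  rw [← Matrix.mulVec_mulVec, ← Matrix.mulVec_mulVec, transS_mulVec, LapS_mulVec, LapS_mulVec]
  refine Finset.sum_congr rfl fun ν _ => ?_
  simp only [transS_mulVec]
  rw [add_right_comm x (unitVec N ν) v, sub_add_eq_add_sub x (unitVec N ν) v]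

/-- `T_v∂ = ∂T_v`. [cite: Balaban1984PropagatorsI, (1.4) p.18] -/
theorem transV_mul_GradOp : transV N v * GradOp N c = GradOp N c * transS N v := by
  refine matrix_eq_of_mulVec_eq fun l => funext fun i => ?_
  obtain ⟨x, μ⟩ := i
  rw [← Matrix.mulVec_mulVec, ← Matrix.mulVec_mulVec, transV_mulVec, GradOp_mulVec, GradOp_mulVec, sdiff_mulVec, sdiff_mulVec, transS_mulVec, transS_mulVec,
    add_right_comm x (unitVec N μ) v]

/-- `T_v∂* = ∂*T_v`. [folklore] -/
theorem transS_mul_GradOp_conjTranspose : transS N v * (GradOp N c)ᴴ = (GradOp N c)ᴴ * transV N v := by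
  have h := congrArg Matrix.conjTranspose (transV_mul_GradOp N c (-v))
  rw [Matrix.conjTranspose_mul, Matrix.conjTranspose_mul, transV_conjTranspose, transS_conjTranspose, neg_neg] at h
  exact h.symm

/-- `T_vΔ = ΔT_v` (vector Laplacian). [cite: Balaban1984PropagatorsI, (1.21) p.21, (1.90) p.33] -/
theorem transV_mul_LapV : transV N v * LapV N c = LapV N c * transV N v := by
  refine matrix_eq_of_mulVec_eq fun u => funext fun i => ?_
  obtain ⟨x, μ⟩ := i
  rw [← Matrix.mulVec_mulVec, ← Matrix.mulVec_mulVec, transV_mulVec, LapV_mulVec_apply, LapV_mulVec_apply]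
  refine Finset.sum_congr rfl fun ν _ => ?_
  rw [transV_mulVec, transV_mulVec, transV_mulVec, add_right_comm x (unitVec N ν) v, sub_add_eq_add_sub x (unitVec N ν) v]

/-- `T_vΠ₀ = Π₀T_v` (`c ≠ 0`). [folklore] -/
theorem transS_mul_Pker (hc : c ≠ 0) : transS N v * Pker N c = Pker N c * transS N v := by
  refine matrix_eq_of_mulVec_eq fun f => ?_
  rw [← Matrix.mulVec_mulVec, ← Matrix.mulVec_mulVec]
  have h1 : transS N v *ᵥ (Pker N c *ᵥ f) = Pker N c *ᵥ f := by
    funext x; rw [transS_mulVec, Pker_const N hc f (x + v), ← Pker_const N hc f x]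
  have h2 : Pker N c *ᵥ (transS N v *ᵥ f - f) = 0 := by
    refine Pker_orth N hc _ ?_
    simp only [Pi.sub_apply, Finset.sum_sub_distrib, transS_mulVec]
    rw [sum_add_right, sub_self]
  rw [h1, eq_comm, ← sub_eq_zero, ← Matrix.mulVec_sub, h2]

/-- `T_vΔ⁻¹ = Δ⁻¹T_v`. [folklore] -/
theorem transS_mul_LapSinv (hc : c ≠ 0) : transS N v * LapSinv N c = LapSinv N c * transS N v :=
  comm_LapSinv_of_comm N c (transS_mul_LapS N c v) (transS_mul_Pker N c v hc)

end Translations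

section BlockTranslations

variable (n : ℕ) [NeZero n] (M : Fin d → ℕ) [∀ μ, NeZero (M μ)] (cv : Tor M)

omit [NeZero n] [∀ μ, NeZero (M μ)] in
/-- a block translation of the fine lattice moves block points to block points: `bpt (y + c) j = bpt y j + n·c`. [folklore] -/
theorem bpt_add (y : Tor M) (j : Fin d → Fin n) : bpt n M (y + cv) j = bpt n M y j + up n M cv := by
  rw [bpt, bpt, B5Block118.up_add]; abel

/-- `T̃_cQ′ = Q′T_{n·c}` (scalar block average (1.20)). [cite: Balaban1984PropagatorsI, (1.20) p.20] -/
theorem transS_mul_QsOp : transS M cv * QsOp n M = QsOp n M * transS (fine n M) (up n M cv) := by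
  refine matrix_eq_of_mulVec_eq fun f => funext fun y => ?_
  rw [← Matrix.mulVec_mulVec, ← Matrix.mulVec_mulVec, transS_mulVec, QsOp_mulVec, QsOp_mulVec]
  congr 1
  refine Finset.sum_congr rfl fun j _ => ?_
  rw [transS_mulVec, bpt_add]

/-- `T̃_cQ = QT_{n·c}` (Bałaban's vector average (1.18)). [cite: Balaban1984PropagatorsI, (1.18) p.20] -/
theorem transV_mul_QvOp : transV M cv * QvOp n M = QvOp n M * transV (fine n M) (up n M cv) := by
  refine matrix_eq_of_mulVec_eq fun A => funext fun i => ?_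
  obtain ⟨y, μ⟩ := i
  rw [← Matrix.mulVec_mulVec, ← Matrix.mulVec_mulVec, transV_mulVec, QvOp_mulVec, QvOp_mulVec]
  congr 1
  refine Finset.sum_congr rfl fun j _ => ?_
  simp only [lineSum, transV_mulVec]
  refine Finset.sum_congr rfl fun t _ => ?_
  rw [bpt_add, add_right_comm]

/-- `T_{n·c}Q* = Q*T̃_c`. [folklore] -/
theorem transV_mul_QvAdj : transV (fine n M) (up n M cv) * QvAdj n M = QvAdj n M * transV M cv := by
  rw [QvAdj, Matrix.mul_smul, Matrix.smul_mul]
  congr 1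
  have h := conjTranspose_comm_transV (N := M) (N' := fine n M) (transV_mul_QvOp n M (-cv))
  have hu : up n M (-cv) = -up n M cv := by funext ν; simp [up]
  simpa [hu] using h

/-- `T_{n·c}Q′ᴴ = Q′ᴴT̃_c`. [folklore] -/
theorem transS_mul_QsOp_conjTranspose : transS (fine n M) (up n M cv) * (QsOp n M)ᴴ = (QsOp n M)ᴴ * transS M cv := by
  have h := conjTranspose_comm_trans (N := M) (N' := fine n M) (transS_mul_QsOp n M (-cv))
  have hu : up n M (-cv) = -up n M cv := by funext ν; simp [up]
  simpa [hu] using h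

variable (c : ℂ)

/-- `T̃_c(Q′Δ⁻²Q′*) = (Q′Δ⁻²Q′*)T̃_c`. [folklore] -/
theorem transS_mul_Mop (hc : c ≠ 0) : transS M cv * Mop n M c = Mop n M c * transS M cv := by
  simp only [Mop, ← Matrix.mul_assoc, transS_mul_QsOp]
  rw [Matrix.mul_assoc (QsOp n M) (transS _ _), transS_mul_LapSinv _ c _ hc, ← Matrix.mul_assoc, Matrix.mul_assoc (QsOp n M * LapSinv _ c) (transS _ _),
    transS_mul_LapSinv _ c _ hc, ← Matrix.mul_assoc, Matrix.mul_assoc _ (transS _ _), transS_mul_QsOp_conjTranspose, ← Matrix.mul_assoc]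

/-- a translation commutes with the constant matrix. [folklore] -/
theorem transS_mul_Cavg : transS M cv * Cavg M = Cavg M * transS M cv := by
  ext x y
  rw [Matrix.mul_apply, Matrix.mul_apply]
  have h : ∀ z : Tor M, (y = z + cv) ↔ (z = y - cv) := fun z => by constructor <;> (rintro rfl; abel)
  simp only [transS, Cavg, ite_mul, one_mul, zero_mul, mul_ite, mul_one, mul_zero, Finset.sum_ite_eq', Finset.mem_univ, if_true]
  simp_rw [h]
  rw [Finset.sum_ite_eq', if_pos (Finset.mem_univ _)]

/-- `T̃_cK = KT̃_c`. [folklore] -/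
theorem transS_mul_Kmat (hc : c ≠ 0) : transS M cv * Kmat n M c = Kmat n M c * transS M cv := by
  rw [Kmat, Matrix.mul_add, Matrix.add_mul, transS_mul_Mop n M cv c hc, transS_mul_Cavg]

/-- `T̃_cK⁻¹ = K⁻¹T̃_c`. [folklore] -/
theorem transS_mul_Minv (hc : c ≠ 0) : transS M cv * Minv n M c = Minv n M c * transS M cv :=
  mul_nonsing_inv_comm ((Matrix.isUnit_iff_isUnit_det _).mp (Kmat_isUnit n M c hc)) (transS_mul_Kmat n M cv c hc)

/-- `T_{n·c}P = PT_{n·c}` for the projection (1.26)∕(1.70) (`P` is invariant under BLOCK translations). [cite: Balaban1984PropagatorsI, (1.26) p.22, (1.70) p.30] -/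
theorem transS_mul_PcT (hc : c ≠ 0) : transS (fine n M) (up n M cv) * PcT n M c = PcT n M c * transS (fine n M) (up n M cv) := by
  show transS (fine n M) (up n M cv) * (LapSinv (fine n M) c * (QsOp n M)ᴴ * Minv n M c * QsOp n M * LapSinv (fine n M) c)
      = LapSinv (fine n M) c * (QsOp n M)ᴴ * Minv n M c * QsOp n M * LapSinv (fine n M) c * transS (fine n M) (up n M cv)
  simp only [Matrix.mul_assoc]
  rw [← Matrix.mul_assoc (transS _ _), transS_mul_LapSinv _ c _ hc, Matrix.mul_assoc, ← Matrix.mul_assoc (transS _ _), transS_mul_QsOp_conjTranspose,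
    Matrix.mul_assoc, ← Matrix.mul_assoc (transS _ _), transS_mul_Minv n M cv c hc, Matrix.mul_assoc, ← Matrix.mul_assoc (transS _ _), transS_mul_QsOp,
    Matrix.mul_assoc, transS_mul_LapSinv _ c _ hc]

variable (a : ℝ)

/-- ★★ **`T_{n·c}Δ_a = Δ_aT_{n·c}`: BAŁABAN's `Δ_a` COMMUTES WITH BLOCK TRANSLATIONS** (translations of `T_η` by unit-lattice vectors). [cite: Balaban1984PropagatorsI, (1.69) p.29, (1.73) p.30] -/
theorem transV_mul_DeltaA : transV (fine n M) (up n M cv) * DeltaA n M a = DeltaA n M a * transV (fine n M) (up n M cv) := by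
  have hc : (n : ℂ) ≠ 0 := Nat.cast_ne_zero.mpr (NeZero.ne n)
  have t2 : transV (fine n M) (up n M cv) * (GradOp (fine n M) (n : ℂ) * PcT n M (n : ℂ) * (GradOp (fine n M) (n : ℂ))ᴴ)
      = GradOp (fine n M) (n : ℂ) * PcT n M (n : ℂ) * (GradOp (fine n M) (n : ℂ))ᴴ * transV (fine n M) (up n M cv) := by
    rw [← Matrix.mul_assoc, ← Matrix.mul_assoc, transV_mul_GradOp, Matrix.mul_assoc (GradOp _ _) (transS _ _), transS_mul_PcT n M cv _ hc, ← Matrix.mul_assoc,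
      Matrix.mul_assoc _ (transS _ _), transS_mul_GradOp_conjTranspose, ← Matrix.mul_assoc]
  have t3 : transV (fine n M) (up n M cv) * (QvAdj n M * QvOp n M) = QvAdj n M * QvOp n M * transV (fine n M) (up n M cv) := by
    rw [← Matrix.mul_assoc, transV_mul_QvAdj, Matrix.mul_assoc, transV_mul_QvOp, ← Matrix.mul_assoc]
  rw [DeltaA, B5Action121.Lap_eq_LapV, Matrix.mul_add, Matrix.mul_sub, Matrix.add_mul, Matrix.sub_mul, Matrix.mul_smul, Matrix.smul_mul,
    transV_mul_LapV, t2, t3]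

/-- ★★ `T_{n·c}G = GT_{n·c}` for `G = Δ_a⁻¹`. [cite: Balaban1984PropagatorsI, (1.71) p.30] -/
theorem transV_mul_DeltaA_inv (hn : 1 ≤ n) (ha : 0 < a) :
    transV (fine n M) (up n M cv) * (DeltaA n M a)⁻¹ = (DeltaA n M a)⁻¹ * transV (fine n M) (up n M cv) :=
  mul_nonsing_inv_comm ((Matrix.isUnit_iff_isUnit_det _).mp (isUnit_DeltaA n hn M a ha)) (transV_mul_DeltaA n M cv a)

/-- the same for `DeltaAR = re Δ_a`. [folklore] -/
theorem reM_transV_mul_DeltaAR : reM (transV (fine n M) (up n M cv)) * DeltaAR n M a = DeltaAR n M a * reM (transV (fine n M) (up n M cv)) := by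
  rw [DeltaAR, ← IsReal.reM_mul (isReal_transV _) (isReal_DeltaA n M a), ← IsReal.reM_mul (isReal_DeltaA n M a) (isReal_transV _), transV_mul_DeltaA]

/-- the same for `GR = re Δ_a⁻¹`. [folklore] -/
theorem reM_transV_mul_GR (hn : 1 ≤ n) (ha : 0 < a) : reM (transV (fine n M) (up n M cv)) * GR n M a = GR n M a * reM (transV (fine n M) (up n M cv)) := by
  rw [GR, ← IsReal.reM_mul (isReal_transV _) (B5RealFields.isReal_DeltaA_inv n M a), ← IsReal.reM_mul (B5RealFields.isReal_DeltaA_inv n M a) (isReal_transV _),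
    transV_mul_DeltaA_inv n M cv a hn ha]

end BlockTranslations

/-! ## §6 Block translations of real 1-forms (`tshiftV`) commute with `Δ_a` and `G`; the reflections in the faces of a translated cube -/

section RealTrans

variable (M : Fin (d + 1) → ℕ) [∀ μ, NeZero (M μ)] (n : ℕ) [NeZero n] (cv : Tor M)

/-- this lineage's translation `tshiftV` IS the real form of `transV`. [folklore] -/
theorem tshiftV_eq_mulVecLin (v : Tor (fine n M)) : tshiftV M n v = Matrix.mulVecLin (reM (transV (fine n M) v)) := by
  refine LinearMap.ext fun A => funext fun i => ?_
  have h := congrFun (IsReal.cplx_mulVec (isReal_transV (N := fine n M) v) A) i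
  rw [B5RealFields.cplx_apply, transV_mulVec] at h
  rw [tshiftV_apply, Matrix.mulVecLin_apply]
  exact Complex.ofReal_injective (by rw [h, B5RealFields.cplx_apply])

variable (a : ℝ)

/-- ★★★ **`τ_{n·c} ∘ Δ_a = Δ_a ∘ τ_{n·c}` on real 1-forms** (block translations). [cite: Balaban1984PropagatorsI, (1.69) p.29] -/
theorem tshiftV_comp_deltaOp : tshiftV M n (up n M cv) ∘ₗ deltaOp M n a = deltaOp M n a ∘ₗ tshiftV M n (up n M cv) := by
  rw [tshiftV_eq_mulVecLin, deltaOp, ← Matrix.mulVecLin_mul, ← Matrix.mulVecLin_mul, reM_transV_mul_DeltaAR]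

/-- ★★★ **`τ_{n·c} ∘ G = G ∘ τ_{n·c}` on real 1-forms** for `G = gOp M n a = Δ_a⁻¹` (`n ≥ 1`, `a > 0`): the torus propagator is invariant under block translations. [cite: Balaban1984PropagatorsI, (1.71) p.30] -/
theorem tshiftV_comp_gOp (hn : 1 ≤ n) (ha : 0 < a) : tshiftV M n (up n M cv) ∘ₗ gOp M n a = gOp M n a ∘ₗ tshiftV M n (up n M cv) := by
  rw [tshiftV_eq_mulVecLin, gOp, ← Matrix.mulVecLin_mul, ← Matrix.mulVecLin_mul, reM_transV_mul_GR n M cv a hn ha]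

variable (κ : Fin (d + 1))

/-- **THE REFLECTION IN THE LOWER `κ`-FACE OF THE TRANSLATED CUBE `□ + c`** (`c` a unit-lattice vector): `τ_{−n·c} ∘ R_κ ∘ τ_{n·c}`, i.e. `x_κ ↦ 2nc_κ − 1 − x_κ` with the bond
twist. [cite: Balaban1984PropagatorsII, (2.37) p.229 (Neumann cubes at arbitrary positions)] -/
def reflVRAt : (Tor (fine n M) × Fin (d + 1) → ℝ) →ₗ[ℝ] (Tor (fine n M) × Fin (d + 1) → ℝ) :=
  tshiftV M n (-up n M cv) ∘ₗ reflVR M n κ ∘ₗ tshiftV M n (up n M cv)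

omit [∀ μ, NeZero (M μ)] [NeZero n] in
/-- `τ_v(τ_{−v}f) = f`. [folklore] -/
theorem tshiftV_tshiftV_neg (v : Tor (fine n M)) (f : Tor (fine n M) × Fin (d + 1) → ℝ) : tshiftV M n v (tshiftV M n (-v) f) = f := by
  funext i; simp

omit [∀ μ, NeZero (M μ)] [NeZero n] in
/-- `τ_{−v}(τ_vf) = f`. [folklore] -/
theorem tshiftV_neg_tshiftV (v : Tor (fine n M)) (f : Tor (fine n M) × Fin (d + 1) → ℝ) : tshiftV M n (-v) (tshiftV M n v f) = f := by
  funext i; simp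

/-- unfolding `R^{(c)}_κ`. [folklore] -/
theorem reflVRAt_apply (f : Tor (fine n M) × Fin (d + 1) → ℝ) :
    reflVRAt M n cv κ f = tshiftV M n (-up n M cv) (reflVR M n κ (tshiftV M n (up n M cv) f)) := rfl

/-- `R^{(c)}_κ(R^{(c)}_κ f) = f`. [folklore] -/
theorem reflVRAt_reflVRAt (f : Tor (fine n M) × Fin (d + 1) → ℝ) : reflVRAt M n cv κ (reflVRAt M n cv κ f) = f := by
  rw [reflVRAt_apply, reflVRAt_apply, tshiftV_tshiftV_neg, reflVR_reflVR, tshiftV_neg_tshiftV]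

/-- ★★★ **`R^{(c)}_κ ∘ G = G ∘ R^{(c)}_κ`**: the torus propagator commutes with the reflection in every face of every block-aligned cube. [cite: Balaban1984PropagatorsII, (2.37) p.229] -/
theorem reflVRAt_comp_gOp (hn : 1 ≤ n) (ha : 0 < a) : reflVRAt M n cv κ ∘ₗ gOp M n a = gOp M n a ∘ₗ reflVRAt M n cv κ := by
  have hneg : -up n M cv = up n M (-cv) := by funext ν; simp [up]
  refine LinearMap.ext fun f => ?_
  have h1 := LinearMap.congr_fun (tshiftV_comp_gOp M n cv a hn ha) f
  have h2 := LinearMap.congr_fun (reflVR_comp_gOp M n κ a hn ha) (tshiftV M n (up n M cv) f)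
  have h3 := LinearMap.congr_fun (tshiftV_comp_gOp M n (-cv) a hn ha) (reflVR M n κ (tshiftV M n (up n M cv) f))
  simp only [LinearMap.comp_apply] at h1 h2 h3 ⊢
  rw [reflVRAt_apply, reflVRAt_apply, h1, h2, hneg, h3]

/-- `R^{(c)}_κ ∘ Δ_a = Δ_a ∘ R^{(c)}_κ`. [folklore] -/
theorem reflVRAt_comp_deltaOp : reflVRAt M n cv κ ∘ₗ deltaOp M n a = deltaOp M n a ∘ₗ reflVRAt M n cv κ := by
  have hneg : -up n M cv = up n M (-cv) := by funext ν; simp [up]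
  refine LinearMap.ext fun f => ?_
  have h1 := LinearMap.congr_fun (tshiftV_comp_deltaOp M n cv a) f
  have h2 := LinearMap.congr_fun (reflVR_comp_deltaOp M n κ a) (tshiftV M n (up n M cv) f)
  have h3 := LinearMap.congr_fun (tshiftV_comp_deltaOp M n (-cv) a) (reflVR M n κ (tshiftV M n (up n M cv) f))
  simp only [LinearMap.comp_apply] at h1 h2 h3 ⊢
  rw [reflVRAt_apply, reflVRAt_apply, h1, h2, hneg, h3]

end RealTrans


end Summit.QuantumFields.YangMills.BalabanUVNodes.N15.TwoGrid
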